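import Mathlib.AlgebraicGeometry.Sites.SmallAffineZariski
import Mathlib.AlgebraicGeometry.Morphisms.Affine
import Mathlib.Tactic.DepRewrite
import HarnessLib

/-!
# The relative spectrum of a quasi-coherent subalgebra of `f_* 𝒪_X`

Let `f : X ⟶ Y` be a quasi-compact quasi-separated morphism of schemes. A **subring datum**
`D` for `f` assigns to every open `U ⊆ Y` a subring `D.ring U ⊆ Γ(X, f⁻¹U)` containing the image
of `Γ(Y, U)`, stable under restriction, and *quasi-coherent*: over an affine open `U` and for
`r ∈ Γ(Y, U)`, the elements of `D.ring (D(r))` are exactly the fractions `s / rⁿ`, `s ∈ D.ring U`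
(`mem_basicOpen_iff`). Examples: the integral closure of `Γ(Y, U)` in `Γ(X, f⁻¹U)` (Mathlib's
relative normalization, `Mathlib.AlgebraicGeometry.Normalization`, whose construction this file
follows step by step), and — the case this file is written for — the invariants of a finite
group acting on `X` by automorphisms over `Y` (quotients of schemes affine over a base by finite
groups, Mumford, *Abelian Varieties*, §7, Thm. p. 66 and §12; SGA 3, Exp. V, §4).

From such a datum we build, by Mathlib's relative gluing
(`AlgebraicGeometry.Scheme.AffineZariskiSite.relativeGluingData`, the gluing datum of a
"quasi-coherent `𝒪_Y`-algebra"), the **relative spectrum** `D.spec = Spec_Y(D.ring)` with its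
affine structure morphism `D.fromSpec : D.spec ⟶ Y`, the open cover by the `Spec (D.ring U)`, `U`
affine, and the identification `Γ(D.spec, fromSpec⁻¹ U) ≅ D.ring U` (`D.objIso`) together with the
computation of `fromSpec` on sections (`D.fromSpec_app`). Morphisms into `D.spec` (in particular
`X ⟶ D.spec`) are constructed in the sequel `SubringSpecLift`.

## Main definitions and results

* `SubringDatum f`; `SubringDatum.diagram`, `diagramMap` (the presheaf of rings `U ↦ D.ring U`
  under `𝒪_Y`); `coequifibered_diagramMap` (it is a quasi-coherent `𝒪_Y`-algebra: localization
  at `r` over affine opens, from `isLocalization_away_of_subring`).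
* `SubringDatum.spec`, `openCover`, `fromSpec`, `ι_fromSpec`, `fromSpec_preimage`,
  `objIso`, `fromSpec_app`; `IsAffineHom D.fromSpec`.

## References

* Mathlib, `Mathlib/AlgebraicGeometry/Normalization.lean` (A. Yang, 2025): the template.
* [StacksProject, Tag 01LQ] (relative spectrum of a quasi-coherent algebra), [Tag 01LH]
  (relative gluing). [MumfordAV1970] §7, §12 (quotients `X → X/G` with `X → X/G` affine).

## Design

Stated for subrings (no `Algebra` instances in the data, as the algebra structure
`Γ(Y, U) → Γ(X, f⁻¹U)` is only a local instance `(f.app U).hom.toAlgebra` in Mathlib). All proofs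
are the ones of `Mathlib.AlgebraicGeometry.Normalization` with `integralClosure` replaced by
`D.ring`; the only new input is the localization lemma `isLocalization_away_of_subring`.
-/

noncomputable section

universe u

open CategoryTheory Limits AlgebraicGeometry

namespace Literature.AlgebraicGeometry.RelativeSpec

/-! ### Localization of a subring along a localization -/

/-- **Subrings of a localization.** Let `R'` be the localization of `R` at `r`, `S ⊆ R` a subring
containing `r` and `S' ⊆ R'` a subring containing the image of `S` whose elements are exactly
the `x` with `rⁿ x ∈ S` for some `n` (inside `R'`). Then `S'` is the localization of `S` at `r`.
(Elementary; this is the affine content of "a quasi-coherent sub-`𝒪_Y`-algebra of `f_* 𝒪_X`".)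
[folklore] -/
theorem isLocalization_away_of_subring {R R' : Type*} [CommRing R] [CommRing R'] [Algebra R R']
    (r : R) [IsLocalization.Away r R'] (S : Subring R) (S' : Subring R') (hr : r ∈ S)
    (hmap : ∀ x ∈ S, algebraMap R R' x ∈ S')
    (hiff : ∀ x : R', x ∈ S' ↔ ∃ n : ℕ, ∃ s ∈ S, algebraMap R R' r ^ n * x = algebraMap R R' s) :
    letI := ((algebraMap R R').restrict S S' hmap).toAlgebra
    IsLocalization.Away (⟨r, hr⟩ : S) S' := by
  letI := ((algebraMap R R').restrict S S' hmap).toAlgebra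
  have halg : ∀ s : S, (algebraMap S S' s : R') = algebraMap R R' s := fun _ ↦ rfl
  refine ⟨?_, ?_, ?_⟩
  · -- powers of `r` become units in `S'`
    rintro ⟨_, n, rfl⟩
    rw [map_pow]
    refine IsUnit.pow n ?_
    set y : R' := IsLocalization.Away.invSelf (S := R') r
    have hy : algebraMap R R' r * y = 1 := IsLocalization.Away.mul_invSelf (S := R') r
    have hyS' : y ∈ S' := (hiff y).mpr ⟨1, 1, S.one_mem, by rw [pow_one, hy, map_one]⟩
    refine IsUnit.of_mul_eq_one ⟨y, hyS'⟩ (Subtype.ext ?_)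
    change algebraMap R R' r * y = 1
    exact hy
  · -- surjectivity up to powers of `r`
    intro z
    obtain ⟨n, s, hs, h⟩ := (hiff z).mp z.2
    refine ⟨⟨⟨s, hs⟩, ⟨_, n, rfl⟩⟩, Subtype.ext ?_⟩
    change (z : R') * algebraMap R R' (r ^ n) = algebraMap R R' s
    rw [map_pow, mul_comm]
    exact h
  · -- kernel
    intro s s' h
    have h' : algebraMap R R' (s : R) = algebraMap R R' (s' : R) := by
      rw [← halg, ← halg, h]
    obtain ⟨⟨_, n, rfl⟩, hn⟩ := IsLocalization.exists_of_eq (M := Submonoid.powers r) h'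
    exact ⟨⟨_, n, rfl⟩, Subtype.ext hn⟩

/-! ### Subring data -/

variable {X Y : Scheme.{u}} (f : X ⟶ Y)

/-- A **subring datum** for `f : X ⟶ Y`: subrings `D.ring U ⊆ Γ(X, f⁻¹U)` for all opens `U ⊆ Y`,
containing `Γ(Y, U)`, stable under restriction, and quasi-coherent over affine opens
(`mem_basicOpen_iff`: `D.ring (D(r))` consists of the `x` with `rⁿ x ∈ D.ring U|_{D(r)}`). The
sheaf `U ↦ D.ring U` is then a quasi-coherent `𝒪_Y`-subalgebra of `f_* 𝒪_X` (Stacks 01LQ);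
e.g. integral closures (Mathlib's normalization) or invariants of a finite group acting over `Y`.
[folklore] -/
structure SubringDatum where
  /-- The subring of `Γ(X, f⁻¹U)` over the open `U ⊆ Y`. -/
  ring (U : Y.Opens) : Subring Γ(X, f ⁻¹ᵁ U)
  /-- Restriction maps `D.ring U` into `D.ring V` for `V ≤ U`. -/
  map_mem {U V : Y.Opens} (i : V ≤ U) {x : Γ(X, f ⁻¹ᵁ U)} (hx : x ∈ ring U) :
    X.presheaf.map (homOfLE (f.preimage_mono i)).op x ∈ ring V
  /-- `D.ring U` contains the image of `Γ(Y, U)`. -/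
  app_mem (U : Y.Opens) (a : Γ(Y, U)) : f.app U a ∈ ring U
  /-- Quasi-coherence: over an affine `U`, `D.ring (D(r))` is `D.ring U` localized at `r`. -/
  mem_basicOpen_iff {U : Y.Opens} (hU : IsAffineOpen U) (r : Γ(Y, U))
    (x : Γ(X, f ⁻¹ᵁ Y.basicOpen r)) :
    x ∈ ring (Y.basicOpen r) ↔ ∃ n : ℕ, ∃ s ∈ ring U,
      X.presheaf.map (homOfLE (f.preimage_mono (Y.basicOpen_le r))).op (f.app U r) ^ n * x =
        X.presheaf.map (homOfLE (f.preimage_mono (Y.basicOpen_le r))).op s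

namespace SubringDatum

variable {f} (D : SubringDatum f)

/-- The presheaf of rings `U ↦ D.ring U` on `Y` (cf. Mathlib `normalizationDiagram`). [folklore] -/
def diagram : Y.Opensᵒᵖ ⥤ CommRingCat where
  obj U := .of (D.ring U.unop)
  map {U V} i :=
    CommRingCat.ofHom ((X.presheaf.map (homOfLE (f.preimage_mono i.unop.le)).op).hom.restrict
      (D.ring U.unop) (D.ring V.unop) fun _ hx ↦ D.map_mem i.unop.le hx)
  map_id U := by
    ext x
    change (X.presheaf.map (homOfLE _).op) x.1 = x.1
    have : (homOfLE (f.preimage_mono (𝟙 U).unop.le)).op = 𝟙 _ := Subsingleton.elim _ _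
    rw [this, X.presheaf.map_id]
    rfl
  map_comp {U V W} i j := by
    ext x
    change (X.presheaf.map (homOfLE _).op) x.1 =
      (X.presheaf.map (homOfLE _).op) ((X.presheaf.map (homOfLE _).op) x.1)
    rw [← CommRingCat.comp_apply, ← X.presheaf.map_comp]
    exact congrArg (fun φ ↦ X.presheaf.map φ x.1) (Subsingleton.elim _ _)

/-- The structure map `𝒪_Y ⟶ D.diagram`, `a ↦ f♯(a)` (cf. Mathlib `normalizationDiagramMap`).
[folklore] -/
def diagramMap : Y.presheaf ⟶ D.diagram where
  app U := CommRingCat.ofHom ((f.app U.unop).hom.codRestrict (D.ring U.unop) (D.app_mem U.unop))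
  naturality {U V} i := by
    ext x
    exact Subtype.ext congr($(f.naturality i) x)

/-- `D.diagramMap` followed by the inclusion into `Γ(X, f⁻¹U)` is `f♯`. [folklore] -/
theorem diagramMap_app_subtype (U : Y.Opens) :
    D.diagramMap.app (.op U) ≫ CommRingCat.ofHom (D.ring U).subtype = f.app U :=
  rfl

variable [QuasiCompact f] [QuasiSeparated f]

open Scheme.AffineZariskiSite

set_option backward.isDefEq.respectTransparency false in
/-- **Quasi-coherence.** The presheaf `D.diagram` under `𝒪_Y` is a quasi-coherent `𝒪_Y`-algebra
in the sense of Mathlib's `NatTrans.Coequifibered`: over an affine `U`, `D.ring (D(r))` is the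
localization of `D.ring U` at `r` (`isLocalization_away_of_subring`, using that
`Γ(X, f⁻¹D(r))` is the localization of `Γ(X, f⁻¹U)` for `f` qcqs, Mathlib
`isLocalization_basicOpen_of_qcqs`). Cf. Mathlib `coequifibered_normalizationDiagramMap`.
[folklore] -/
theorem coequifibered_diagramMap :
    ((toOpensFunctor Y).op.whiskerLeft D.diagramMap).Coequifibered := by
  refine coequifibered_iff_forall_isLocalizationAway.mpr fun U r ↦ ?_
  let inst : Algebra Γ(X, f ⁻¹ᵁ U.1) Γ(X, f ⁻¹ᵁ Y.basicOpen r) :=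
    (X.presheaf.map (homOfLE (f.preimage_mono (Y.basicOpen_le r))).op).hom.toAlgebra
  have : IsLocalization.Away (f.app U.1 r) Γ(X, f ⁻¹ᵁ Y.basicOpen r) := by
    let : Algebra Γ(X, f ⁻¹ᵁ U.1) Γ(X, X.basicOpen (f.app _ r)) :=
      (X.presheaf.map (homOfLE (X.basicOpen_le _)).op).hom.toAlgebra
    dsimp +instances [inst]
    rw! (castMode := .all) [f.preimage_basicOpen r]
    exact isLocalization_basicOpen_of_qcqs (f.isCompact_preimage U.2.isCompact)
        (f.isQuasiSeparated_preimage U.2.isQuasiSeparated) (f.app _ r)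
  exact isLocalization_away_of_subring (f.app U.1 r) (D.ring U.1) (D.ring (Y.basicOpen r))
    (D.app_mem U.1 r) (fun _ hx ↦ D.map_mem (Y.basicOpen_le r) hx)
    (fun x ↦ D.mem_basicOpen_iff U.2 r x)

/-- The relative gluing datum of the quasi-coherent `𝒪_Y`-algebra `D.ring` (Mathlib
`relativeGluingData`; cf. `normalizationGlueData`). [folklore] -/
def glueData : (directedCover Y).RelativeGluingData :=
  relativeGluingData D.coequifibered_diagramMap

/-- The gluing diagram `U ↦ Spec (D.ring U)` is locally directed (Mathlib, relative gluing).
[folklore] -/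
instance isLocallyDirected_glueData_functor :
    (D.glueData.functor ⋙ Scheme.forget).IsLocallyDirected :=
  Scheme.Cover.RelativeGluingData.instIsLocallyDirectedI₀CompFunctorForgetOfIsThin ..

/-- **The relative spectrum** `Spec_Y(D.ring)` of the quasi-coherent `𝒪_Y`-algebra `U ↦ D.ring U`,
glued from the `Spec (D.ring U)`, `U` affine (Stacks 01LQ; cf. Mathlib `normalization`).
[folklore] -/
def spec : Scheme.{u} := D.glueData.glued

/-- The open cover of `D.spec` by the `Spec (D.ring U)`, `U ⊆ Y` affine open. [folklore] -/
def openCover : D.spec.OpenCover := D.glueData.cover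

/-- The structure morphism `Spec_Y(D.ring) ⟶ Y` (cf. Mathlib `fromNormalization`). [folklore] -/
def fromSpec : D.spec ⟶ Y := D.glueData.toBase

/-- On the chart over an affine `U`, `fromSpec` is `Spec` of `Γ(Y, U) → D.ring U` followed by
`U ↪ Y`. [folklore] -/
@[reassoc]
theorem ι_fromSpec (U : Y.affineOpens) :
    D.openCover.f U ≫ D.fromSpec = Spec.map (D.diagramMap.app (.op U.1)) ≫ U.2.fromSpec :=
  colimit.ι_desc _ _

/-- The chart over an affine `U` is exactly `fromSpec⁻¹ U`. [folklore] -/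
theorem fromSpec_preimage (U : Y.affineOpens) :
    D.fromSpec ⁻¹ᵁ U = (D.openCover.f U).opensRange := by
  simpa using! D.glueData.toBase_preimage_eq_opensRange_ι U

set_option backward.isDefEq.respectTransparency false in
/-- `fromSpec : Spec_Y(D.ring) ⟶ Y` is an affine morphism (its restriction over an affine `U` is
`Spec (D.ring U) → U`). [folklore] -/
instance isAffineHom_fromSpec : IsAffineHom D.fromSpec := by
  rw [IsZariskiLocalAtTarget.iff_of_iSup_eq_top (P := @IsAffineHom) _
    (iSup_affineOpens_eq_top _)]
  intro U
  let e := IsOpenImmersion.isoOfRangeEq (D.fromSpec ⁻¹ᵁ U).ι (D.openCover.f U)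
      (by simpa using congr($(D.fromSpec_preimage U).1))
  rw [← MorphismProperty.cancel_left_of_respectsIso @IsAffineHom e.inv,
    ← MorphismProperty.cancel_right_of_respectsIso @IsAffineHom _ U.2.isoSpec.hom]
  have : IsAffineHom (Spec.map (D.diagramMap.app (.op U))) := inferInstance
  convert! this
  rw [← cancel_mono U.2.fromSpec]
  simp [IsAffineOpen.isoSpec_hom, e, ι_fromSpec]

/-- **Sections over an affine.** `Γ(Spec_Y(D.ring), fromSpec⁻¹ U) ≅ D.ring U` for `U` affine
(cf. Mathlib `normalizationObjIso`). [folklore] -/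
def objIso {U : Y.Opens} (hU : IsAffineOpen U) :
    Γ(D.spec, D.fromSpec ⁻¹ᵁ U) ≅ .of (D.ring U) :=
  D.spec.presheaf.mapIso (eqToIso
    (by simpa using! (D.fromSpec_preimage ⟨U, hU⟩).symm)).op ≪≫
  (D.openCover.f ⟨U, hU⟩).appIso ⊤ ≪≫ Scheme.ΓSpecIso _

set_option backward.isDefEq.respectTransparency false in
/-- **`fromSpec` on sections over an affine** is `Γ(Y, U) → D.ring U` followed by `objIso⁻¹`
(cf. Mathlib `fromNormalization_app`). [folklore] -/
@[reassoc]
theorem fromSpec_app {U : Y.Opens} (hU : IsAffineOpen U) :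
    D.fromSpec.app U = D.diagramMap.app (.op U) ≫ (D.objIso hU).inv := by
  have : IsIso ((D.openCover.f ⟨U, hU⟩).app (D.fromSpec ⁻¹ᵁ U)) :=
    Scheme.Hom.isIso_app _ _ (by simp [← fromSpec_preimage])
  have H : ⊤ = (D.openCover.f ⟨U, hU⟩ ≫ D.fromSpec) ⁻¹ᵁ U := by
    rw [D.ι_fromSpec]; simp
  rw [← cancel_mono ((D.openCover.f ⟨U, hU⟩).app (D.fromSpec ⁻¹ᵁ U)),
    ← Scheme.Hom.comp_app, Scheme.Hom.congr_app (D.ι_fromSpec ⟨U, hU⟩) U,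
    ← cancel_mono ((D.openCover.X ⟨U, hU⟩).presheaf.map (eqToHom H).op)]
  dsimp [objIso]
  rw [IsAffineOpen.fromSpec_app_self]
  simp only [Scheme.Hom.app_eq_appLE, Category.assoc, Scheme.Hom.map_appLE,
    Scheme.Hom.appLE_map]
  simp [Scheme.Hom.appLE, ← Scheme.ΓSpecIso_inv_naturality]
  rfl

end SubringDatum

end Literature.AlgebraicGeometry.RelativeSpec
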